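import Summits.QuantumFields.YangMills.Theorems.FlatTubeReductionDressedClusterAbsorption
import HarnessLib

/-!
# CLUSTER ABSORPTION WITH AN ADDITIVE SECOND-MOMENT POTENTIAL: `⟨ΨW, K_β ΨW⟩ + μ∫D·Ψ² ≤ λ_k·(1 + O(second moments))·‖Ψ‖²`
# (abstract heart of the dressed one-site no-intruder WITH POTENTIAL of skeleton «ratepack-v3 / frozen fibres»; route `FlatTubeReduction`, crux K1 `NearFlatRatioLaw`
# stmt-QuantumFields-24720; seat `ym-line-ftr-p1` g12; R2b1 RECORD rung — no summit statement is proved here)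

WHY (lead g12, crux workfile `Cruxes/NearFlatRatioLaw/Lines/ratepack-v3-frozen-g12.md`): with FROZEN (slow-point independent) fibre profiles the rate-grade Born–Oppenheimer bricks
of crux K1 hold only with error terms of the shape `O(λ_b²) + O(orbitDist(slow mean)²)` — the off-diagonal Feshbach coupling of a frozen fibre state is first order in the slow
amplitude, so after the completed square the one-site comparison inherits an ADDITIVE POTENTIAL `μ·∫ D·Ψ²` with `D ≍ orbitDist²` on the slow window (`D ≤ κ_D` there,
`κ_D = O(λ_b)` on the `β^{-1/6}` window, exactly like the dressing `sup|W²−1|`).  This file shows that such a potential is absorbed by the SAME mechanism as the dressing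
(`qform_dressed_le_of_cluster`, p657808): split `Ψ` along the exact eigenfamily `e₀,…,e_n`; OFF the span the potential is bounded by `κ_D‖Ψ_off‖²` and eaten by the gap
(`2κ̄λ_n + 2μκ_D ≤ λ_k − λ_n`), ON the span it costs the second-moment form `V_D` of the eigenfunctions (the (EM) input):
  ★★★ `qform_dressed_pot_le_of_cluster`: `⟨ΨW, K_β ΨW⟩ + μ∫DΨ² ≤ (λ_k + 2λ_nV + 2μV_D + (λ_k − λ_n)(2w + w²))·‖Ψ‖²` for physical `Ψ` supported in the invariant window `S`,
  `ΨW ⊥ e_{<k}` (any `L`; the one-site model is `L = 1`).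
So the rate twin of the crux needs NO adapted fibres: frozen fibres + `orbitDist²`-shaped error budgets + (EM).
HONEST FRAMING: fixed-lattice linear algebra over tree objects (Reed–Simon XIII.1); (EM)-type inputs and the fibre bricks stay OPEN elsewhere; femto rung R2b1 (RECORD label);
not infinite volume, not a gap, not Clay.  No defs, no named facts, no `sorry`.
-/

set_option autoImplicit false

noncomputable section

open MeasureTheory Filter Topology Real
open scoped BigOperators
open Literature.MathematicalPhysics.QuantumFieldTheory
open Literature.MathematicalPhysics.QuantumLattice

namespace Summit.QuantumFields.YangMills.Theorems.FemtoTransferGap.RateTube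

open Summit.QuantumFields.YangMills.Theorems.FemtoTransferGap
open Summit.QuantumFields.YangMills.Theorems.FemtoTransferGap.OffTube
open Summit.QuantumFields.YangMills.Theorems.FemtoTransferGap.TwoLattice.ConstTube (l2_self_eq_integral_sq)

variable {L : ℕ} [NeZero L]

/-! ## §1 The weighted square of a split function -/

omit [NeZero L] in
/-- Pointwise: for `D ≥ 0`, `D·(P + R)² ≤ 2·D·P² + 2·D·R²`. [folklore] -/
theorem weight_mul_add_sq_le {D P R : ℝ} (hD : 0 ≤ D) : D * (P + R) ^ 2 ≤ 2 * (D * P ^ 2) + 2 * (D * R ^ 2) := by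
  nlinarith [mul_nonneg hD (sq_nonneg (P - R))]

/-- ★ **The potential of a split test function.**  `D ≥ 0` bounded measurable with `D ≤ κ_D` on a set `S`; `Ψ = P + R` physical, supported in `S`, with `P`, `R` physical,
`∫ D·P² ≤ V_D·p` and `‖R‖² = N − p`.  Then `∫ D·Ψ² ≤ 2V_D·p + 2κ_D·(N − p)`. [folklore] -/
theorem integral_weight_sq_split_le {D : GaugeConfig 3 L SU2 → ℝ} (hDm : Measurable D) {CD : ℝ} (hDb : ∀ U, |D U| ≤ CD) (hD0 : ∀ U, 0 ≤ D U)
    {S : Set (GaugeConfig 3 L SU2)} {κD : ℝ} (hκD0 : 0 ≤ κD) (hDκ : ∀ U ∈ S, D U ≤ κD)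
    {Ψ P R : GaugeConfig 3 L SU2 → ℝ} (hΨ : IsPhys Ψ) (hP : IsPhys P) (hR : IsPhys R) (hsplit : ∀ U, Ψ U = P U + R U)
    (hΨS : ∀ U, Ψ U ≠ 0 → U ∈ S) {VD p N : ℝ}
    (hVP : ∫ U, D U * P U ^ 2 ∂configMeasure SU2 L ≤ VD * p) (hRR : l2 R R = N - p) :
    ∫ U, D U * Ψ U ^ 2 ∂configMeasure SU2 L ≤ 2 * VD * p + 2 * κD * (N - p) := by
  obtain ⟨CΨ, hCΨ⟩ := hΨ.bounded
  obtain ⟨CP, hCP⟩ := hP.bounded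
  obtain ⟨CR, hCR⟩ := hR.bounded
  have hCD : 0 ≤ CD := (abs_nonneg _).trans (hDb 1)
  -- the indicator-truncated weight `D_S = 𝟙_S·D ≤ κ_D`
  set DS : GaugeConfig 3 L SU2 → ℝ := fun U => if Ψ U ≠ 0 then D U else 0 with hDSdef
  have hDSm : Measurable DS := Measurable.ite (hΨ.measurable (measurableSet_singleton (0 : ℝ)).compl) hDm measurable_const
  have hDS0 : ∀ U, 0 ≤ DS U := fun U => by simp only [hDSdef]; split_ifs; exacts [hD0 U, le_rfl]
  have hDSκ : ∀ U, DS U ≤ κD := fun U => by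
    simp only [hDSdef]; split_ifs with h
    · exact hDκ U (hΨS U h)
    · exact hκD0
  have hDSb : ∀ U, |DS U| ≤ CD := fun U => by
    simp only [hDSdef]; split_ifs
    · exact hDb U
    · rw [abs_zero]; exact hCD
  have hDSle : ∀ U, DS U ≤ D U := fun U => by simp only [hDSdef]; split_ifs; exacts [le_rfl, hD0 U]
  -- `D·Ψ² = D_S·Ψ² ≤ 2 D P² + 2 D_S R²`
  have hpt : ∀ U, D U * Ψ U ^ 2 ≤ 2 * (D U * P U ^ 2) + 2 * (DS U * R U ^ 2) := by
    intro U
    by_cases h : Ψ U ≠ 0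
    · have hDSU : DS U = D U := by simp only [hDSdef]; rw [if_pos h]
      rw [hDSU, hsplit U]; exact weight_mul_add_sq_le (hD0 U)
    · push Not at h
      rw [h]
      have h1 : 0 ≤ D U * P U ^ 2 := mul_nonneg (hD0 U) (sq_nonneg _)
      have h2 : 0 ≤ DS U * R U ^ 2 := mul_nonneg (hDS0 U) (sq_nonneg _)
      nlinarith [h1, h2]
  have hiΨ : Integrable (fun U => D U * Ψ U ^ 2) (configMeasure SU2 L) :=
    integrable_of_measurable_abs_le _ (hDm.mul (hΨ.measurable.pow_const 2)) (C := CD * CΨ ^ 2) fun U => by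
      rw [abs_mul, abs_pow]; exact mul_le_mul (hDb U) (pow_le_pow_left₀ (abs_nonneg _) (hCΨ U) 2) (by positivity) hCD
  have hiP : Integrable (fun U => D U * P U ^ 2) (configMeasure SU2 L) :=
    integrable_of_measurable_abs_le _ (hDm.mul (hP.measurable.pow_const 2)) (C := CD * CP ^ 2) fun U => by
      rw [abs_mul, abs_pow]; exact mul_le_mul (hDb U) (pow_le_pow_left₀ (abs_nonneg _) (hCP U) 2) (by positivity) hCD
  have hiR : Integrable (fun U => DS U * R U ^ 2) (configMeasure SU2 L) :=
    integrable_of_measurable_abs_le _ (hDSm.mul (hR.measurable.pow_const 2)) (C := CD * CR ^ 2) fun U => by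
      rw [abs_mul, abs_pow]; exact mul_le_mul (hDSb U) (pow_le_pow_left₀ (abs_nonneg _) (hCR U) 2) (by positivity) hCD
  have hint : ∫ U, D U * Ψ U ^ 2 ∂configMeasure SU2 L ≤ 2 * ∫ U, D U * P U ^ 2 ∂configMeasure SU2 L + 2 * ∫ U, DS U * R U ^ 2 ∂configMeasure SU2 L := by
    rw [← integral_const_mul, ← integral_const_mul, ← integral_add (hiP.const_mul 2) (hiR.const_mul 2)]
    exact integral_mono hiΨ ((hiP.const_mul 2).add (hiR.const_mul 2)) fun U => hpt U
  have hκR : ∫ U, DS U * R U ^ 2 ∂configMeasure SU2 L ≤ κD * (N - p) := by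
    rw [← hRR, l2_self_eq_integral_sq, ← integral_const_mul]
    refine integral_mono hiR ((integrable_of_measurable_abs_le _ (hR.measurable.pow_const 2) (C := CR ^ 2) fun U => by
      rw [abs_pow]; exact pow_le_pow_left₀ (abs_nonneg _) (hCR U) 2).const_mul κD) fun U => ?_
    exact mul_le_mul_of_nonneg_right (hDSκ U) (sq_nonneg _)
  linarith [hint, hVP, hκR]

/-! ## §2 ★★★ Cluster absorption for a dressed test function with an additive potential -/

set_option maxHeartbeats 800000 in
/-- ★★★ **CLUSTER ABSORPTION WITH POTENTIAL.**  `β > 0`; `e₀,…,e_n` an `l2`-orthonormal physical exact eigenfamily with Courant–Fischer domination; `k ≤ n`; a bounded measurable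
gauge- and twist-invariant weight `W` and invariant window `S` with `|W² − 1| ≤ κ̄` on `S`; a bounded measurable potential `D ≥ 0` with `D ≤ κ_D` on `S` and a coupling `μ ≥ 0`;
the DRESSED SECOND-MOMENT FORM `∫_S |W²−1|(Σcᵢeᵢ)² ≤ V·Σcᵢ²`, the POTENTIAL SECOND-MOMENT FORM `∫ D(Σcᵢeᵢ)² ≤ V_D·Σcᵢ²`, the overlaps `Σᵢ ‖𝟙_S(W−1)eᵢ‖² ≤ w²`; and the
GAP CONDITION `2κ̄λ_n + 2μκ_D ≤ λ_k − λ_n`.  Then every physical `Ψ` supported in `S` with `ΨW ⊥ e₀,…,e_{k−1}` satisfies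
`⟨ΨW, K_β ΨW⟩ + μ·∫ D·Ψ² ≤ (λ_k + 2λ_nV + 2μV_D + (λ_k − λ_n)(2w + w²))·‖Ψ‖²` (norm UNDRESSED): both the dressing excess and the potential are absorbed by the gap off the span
and cost second moments on it. [cite: ReedSimonIV1978, Thm. XIII.1] [cite: Luscher1983, §3] -/
theorem qform_dressed_pot_le_of_cluster {β : ℝ} (hβ : 0 < β) {n : ℕ} {e : Fin (n + 1) → GaugeConfig 3 L SU2 → ℝ} (he : ∀ i, IsPhys (e i))
    (hon : ∀ i l, l2 (e i) (e l) = if i = l then 1 else 0)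
    (heig : ∀ i : Fin (n + 1), transferApply β (e i) = levelValue su2Rep L β (i : ℕ) • e i)
    (hdom : ∀ (j : Fin (n + 1)) (ψ : GaugeConfig 3 L SU2 → ℝ), IsPhys ψ → (∀ i : Fin (n + 1), i < j → l2 ψ (e i) = 0) →
      qform su2Rep β ψ ψ ≤ levelValue su2Rep L β j * l2 ψ ψ)
    {k : ℕ} (hkn : k ≤ n)
    {W : GaugeConfig 3 L SU2 → ℝ} (hWm : Measurable W) {CW : ℝ} (hWb : ∀ U, |W U| ≤ CW)
    (hWg : ∀ (g : Site 3 L → SU2) (U : GaugeConfig 3 L SU2), W (gaugeTransform g U) = W U)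
    (hWz : ∀ (j : Fin 3), ∀ z ∈ Subgroup.center SU2, ∀ U : GaugeConfig 3 L SU2, W (twist j z U) = W U)
    {S : Set (GaugeConfig 3 L SU2)} (hSm : MeasurableSet S)
    (hSg : ∀ (g : Site 3 L → SU2) (U : GaugeConfig 3 L SU2), gaugeTransform g U ∈ S ↔ U ∈ S)
    (hSz : ∀ (j : Fin 3), ∀ z ∈ Subgroup.center SU2, ∀ U : GaugeConfig 3 L SU2, twist j z U ∈ S ↔ U ∈ S)
    {κ V w : ℝ} (hκ0 : 0 ≤ κ) (hκ : ∀ U ∈ S, |W U ^ 2 - 1| ≤ κ) (hV0 : 0 ≤ V)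
    (hV : ∀ c : Fin (n + 1) → ℝ, ∫ U, S.indicator (fun U => |W U ^ 2 - 1|) U * (∑ i, c i * e i U) ^ 2 ∂configMeasure SU2 L ≤ V * ∑ i, c i ^ 2)
    (hw0 : 0 ≤ w) (hw : ∑ i : Fin (n + 1), l2 (fun U => S.indicator 1 U * (W U - 1) * e i U) (fun U => S.indicator 1 U * (W U - 1) * e i U) ≤ w ^ 2)
    {D : GaugeConfig 3 L SU2 → ℝ} (hDm : Measurable D) {CD : ℝ} (hDb : ∀ U, |D U| ≤ CD) (hD0 : ∀ U, 0 ≤ D U)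
    {κD VD μ : ℝ} (hκD0 : 0 ≤ κD) (hDκ : ∀ U ∈ S, D U ≤ κD) (hVD0 : 0 ≤ VD) (hμ0 : 0 ≤ μ)
    (hVD : ∀ c : Fin (n + 1) → ℝ, ∫ U, D U * (∑ i, c i * e i U) ^ 2 ∂configMeasure SU2 L ≤ VD * ∑ i, c i ^ 2)
    (hgap : 2 * κ * levelValue su2Rep L β n + 2 * μ * κD ≤ levelValue su2Rep L β k - levelValue su2Rep L β n)
    {Ψ : GaugeConfig 3 L SU2 → ℝ} (hΨ : IsPhys Ψ) (hΨS : ∀ U, Ψ U ≠ 0 → U ∈ S)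
    (hperp : ∀ i : Fin (n + 1), (i : ℕ) < k → l2 (fun U => W U * Ψ U) (e i) = 0) :
    qform su2Rep β (fun U => W U * Ψ U) (fun U => W U * Ψ U) + μ * ∫ U, D U * Ψ U ^ 2 ∂configMeasure SU2 L ≤
      (levelValue su2Rep L β k + 2 * levelValue su2Rep L β n * V + 2 * μ * VD +
        (levelValue su2Rep L β k - levelValue su2Rep L β n) * (2 * w + w ^ 2)) * l2 Ψ Ψ := by
  classical
  set lam : ℕ → ℝ := fun j => levelValue su2Rep L β j with hlam
  -- the dressed test function is physical
  set ψ : GaugeConfig 3 L SU2 → ℝ := fun U => W U * Ψ U with hψdef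
  have hψ : IsPhys ψ := hΨ.mul_of_invariant hWm hWb hWg hWz
  -- the two-level bound applied to `ψ`
  have htwo := qform_le_two_level he hon heig hdom hkn hψ hperp
  -- the undressed coefficients `a_i = ⟨Ψ, e_i⟩` (`i < n`), the span part `P` and the rest `R`
  set a : Fin (n + 1) → ℝ := fun i => if (i : ℕ) < n then l2 Ψ (e i) else 0 with hadef
  set P : GaugeConfig 3 L SU2 → ℝ := fun U => ∑ i, a i * e i U with hPdef
  have hP : IsPhys P := isPhys_sum_mul_lat Finset.univ e he a
  set R : GaugeConfig 3 L SU2 → ℝ := fun U => Ψ U - P U with hRdef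
  have hR : IsPhys R := OpPlat.isPhys_sub hΨ hP
  set N : ℝ := l2 Ψ Ψ with hNdef
  set p : ℝ := ∑ i, a i ^ 2 with hpdef
  have hN0 : 0 ≤ N := l2_self_nonneg_lat Ψ
  have hp0 : 0 ≤ p := Finset.sum_nonneg fun i _ => sq_nonneg _
  have haa : ∀ i, a i * l2 Ψ (e i) = a i ^ 2 := fun i => by
    by_cases hi : (i : ℕ) < n <;> simp [hadef, hi, sq]
  obtain ⟨hPP, -⟩ := forms_of_eigenfamily_lat he hon heig a
  have hΨP : l2 Ψ P = p := by
    rw [l2_comm, hPdef, l2_sum_mul_left_lat Finset.univ e he a hΨ]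
    exact Finset.sum_congr rfl fun i _ => by rw [l2_comm]; exact haa i
  -- `‖R‖² = N − p`, hence `p ≤ N`
  have hRR : l2 R R = N - p := by
    have e1 : R = Ψ + (-1 : ℝ) • P := by funext U; simp only [hRdef, Pi.add_apply, Pi.smul_apply, smul_eq_mul]; ring
    have e2 : l2 Ψ ((-1 : ℝ) • P) = -1 * l2 Ψ P := by rw [l2_comm, l2_smul_left, l2_comm]
    rw [e1, l2_add_add hΨ (hP.smul _), e2, OpPlat.l2_smul_smul, hΨP, hPP]; ring
  have hpN : p ≤ N := by have := l2_self_nonneg_lat R; linarith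
  -- bounded-measurable data for the integral manipulations
  obtain ⟨CΨ, hCΨ⟩ := hΨ.bounded
  obtain ⟨CP, hCP⟩ := hP.bounded
  obtain ⟨CR, hCR⟩ := hR.bounded
  have hCΨ0 : 0 ≤ CΨ := (abs_nonneg _).trans (hCΨ 1)
  have hCW0 : 0 ≤ CW := (abs_nonneg _).trans (hWb 1)
  have hW21 : ∀ U, |W U ^ 2 - 1| ≤ CW ^ 2 + 1 := fun U => by
    have h1 : |W U ^ 2| ≤ CW ^ 2 := by rw [abs_pow]; exact pow_le_pow_left₀ (abs_nonneg _) (hWb U) 2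
    calc |W U ^ 2 - 1| ≤ |W U ^ 2| + |(1 : ℝ)| := abs_sub _ _
      _ ≤ CW ^ 2 + 1 := by rw [abs_one]; linarith
  have hindm : Measurable (S.indicator (fun U => |W U ^ 2 - 1|)) :=
    (((hWm.pow_const 2).sub measurable_const).abs).indicator hSm
  have hindb : ∀ U, |S.indicator (fun U => |W U ^ 2 - 1|) U| ≤ CW ^ 2 + 1 := fun U => by
    by_cases hU : U ∈ S
    · rw [Set.indicator_of_mem hU, abs_abs]; exact hW21 U
    · rw [Set.indicator_of_notMem hU, abs_zero]; positivity
  have hindκ : ∀ U ∈ S, S.indicator (fun U => |W U ^ 2 - 1|) U ≤ κ := fun U hU => by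
    rw [Set.indicator_of_mem hU]; exact hκ U hU
  have hind0 : ∀ U, 0 ≤ S.indicator (fun U => |W U ^ 2 - 1|) U := fun U => by
    by_cases hU : U ∈ S
    · rw [Set.indicator_of_mem hU]; exact abs_nonneg _
    · rw [Set.indicator_of_notMem hU]
  -- (i) `‖ΨW‖² = N + X`, `X = ∫ (W²−1)Ψ²`
  set X : ℝ := ∫ U, (W U ^ 2 - 1) * Ψ U ^ 2 ∂configMeasure SU2 L with hXdef
  have hψψ : l2 ψ ψ = N + X := by
    rw [l2_self_eq_integral_sq, hNdef, l2_self_eq_integral_sq, hXdef, ← integral_add]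
    · exact integral_congr_ae (ae_of_all _ fun U => by simp only [hψdef]; ring)
    · exact integrable_of_measurable_abs_le _ (hΨ.measurable.pow_const 2) (C := CΨ ^ 2) fun U => by rw [abs_pow]; exact pow_le_pow_left₀ (abs_nonneg _) (hCΨ U) 2
    · exact integrable_of_measurable_abs_le _ (((hWm.pow_const 2).sub measurable_const).mul (hΨ.measurable.pow_const 2)) (C := (CW ^ 2 + 1) * CΨ ^ 2) fun U => by
        rw [abs_mul, abs_pow]; exact mul_le_mul (hW21 U) (pow_le_pow_left₀ (abs_nonneg _) (hCΨ U) 2) (by positivity) (by positivity)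
  -- (ii) `X ≤ 2Vp + 2κ̄(N − p)` : the weight `𝟙_S|W²−1|` against the split `Ψ = P + R`
  have hX : X ≤ 2 * V * p + 2 * κ * (N - p) := by
    have hX' : X ≤ ∫ U, S.indicator (fun U => |W U ^ 2 - 1|) U * Ψ U ^ 2 ∂configMeasure SU2 L := by
      rw [hXdef]
      refine integral_mono ?_ ?_ fun U => ?_
      · exact integrable_of_measurable_abs_le _ (((hWm.pow_const 2).sub measurable_const).mul (hΨ.measurable.pow_const 2)) (C := (CW ^ 2 + 1) * CΨ ^ 2) fun U => by
          rw [abs_mul, abs_pow]; exact mul_le_mul (hW21 U) (pow_le_pow_left₀ (abs_nonneg _) (hCΨ U) 2) (by positivity) (by positivity)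
      · exact integrable_of_measurable_abs_le _ (hindm.mul (hΨ.measurable.pow_const 2)) (C := (CW ^ 2 + 1) * CΨ ^ 2) fun U => by
          rw [abs_mul, abs_pow]; exact mul_le_mul (hindb U) (pow_le_pow_left₀ (abs_nonneg _) (hCΨ U) 2) (by positivity) (by positivity)
      · dsimp only
        by_cases hU : U ∈ S
        · rw [Set.indicator_of_mem hU]; exact mul_le_mul_of_nonneg_right (le_abs_self _) (sq_nonneg _)
        · have hΨ0 : Ψ U = 0 := by by_contra h; exact hU (hΨS U h)
          rw [hΨ0, Set.indicator_of_notMem hU]; simp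
    have hsplit := integral_weight_sq_split_le hindm hindb hind0 hκ0 hindκ hΨ hP hR (fun U => by simp only [hRdef]; ring) hΨS
      (VD := V) (p := p) (N := N) (hV a) hRR
    linarith [hX', hsplit]
  -- (ii') `Y = ∫ DΨ² ≤ 2V_D p + 2κ_D(N − p)` : the same split for the potential
  set Y : ℝ := ∫ U, D U * Ψ U ^ 2 ∂configMeasure SU2 L with hYdef
  have hY : Y ≤ 2 * VD * p + 2 * κD * (N - p) :=
    integral_weight_sq_split_le hDm hDb hD0 hκD0 hDκ hΨ hP hR (fun U => by simp only [hRdef]; ring) hΨS (hVD a) hRR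
  have hY0 : 0 ≤ Y := integral_nonneg fun U => mul_nonneg (hD0 U) (sq_nonneg _)
  -- (iii) the dressed coefficients: `⟨ΨW, e_i⟩ = a_i + ε_i` for `i < n`, `Σ ε_i² ≤ w²N`
  set J : Fin (n + 1) → GaugeConfig 3 L SU2 → ℝ := fun i U => S.indicator 1 U * (W U - 1) * e i U with hJdef
  have hJphys : ∀ i, IsPhys (J i) := by
    intro i
    have hm : Measurable (fun U => S.indicator (1 : GaugeConfig 3 L SU2 → ℝ) U * (W U - 1)) :=
      ((measurable_const.indicator hSm).mul (hWm.sub measurable_const))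
    have hb : ∀ U, |S.indicator (1 : GaugeConfig 3 L SU2 → ℝ) U * (W U - 1)| ≤ CW + 1 := fun U => by
      rw [abs_mul]
      have h1 : |S.indicator (1 : GaugeConfig 3 L SU2 → ℝ) U| ≤ 1 := by
        by_cases hU : U ∈ S
        · rw [Set.indicator_of_mem hU]; simp
        · rw [Set.indicator_of_notMem hU]; simp
      have h2 : |W U - 1| ≤ CW + 1 := (abs_sub _ _).trans (by rw [abs_one]; linarith [hWb U])
      calc |S.indicator (1 : GaugeConfig 3 L SU2 → ℝ) U| * |W U - 1| ≤ 1 * (CW + 1) := mul_le_mul h1 h2 (abs_nonneg _) zero_le_one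
        _ = CW + 1 := one_mul _
    have hg' : ∀ (g : Site 3 L → SU2) (U : GaugeConfig 3 L SU2),
        S.indicator (1 : GaugeConfig 3 L SU2 → ℝ) (gaugeTransform g U) * (W (gaugeTransform g U) - 1) = S.indicator 1 U * (W U - 1) := fun g U => by
      rw [hWg g U]
      by_cases hU : U ∈ S
      · rw [Set.indicator_of_mem hU, Set.indicator_of_mem ((hSg g U).mpr hU), Pi.one_apply, Pi.one_apply]
      · rw [Set.indicator_of_notMem hU, Set.indicator_of_notMem (fun h => hU ((hSg g U).mp h))]
    have hz' : ∀ (j : Fin 3), ∀ z ∈ Subgroup.center SU2, ∀ U : GaugeConfig 3 L SU2,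
        S.indicator (1 : GaugeConfig 3 L SU2 → ℝ) (twist j z U) * (W (twist j z U) - 1) = S.indicator 1 U * (W U - 1) := fun j z hz U => by
      rw [hWz j z hz U]
      by_cases hU : U ∈ S
      · rw [Set.indicator_of_mem hU, Set.indicator_of_mem ((hSz j z hz U).mpr hU), Pi.one_apply, Pi.one_apply]
      · rw [Set.indicator_of_notMem hU, Set.indicator_of_notMem (fun h => hU ((hSz j z hz U).mp h))]
    have := (he i).mul_of_invariant hm hb hg' hz'
    simpa only [hJdef, mul_assoc] using this
  have hcoef : ∀ i : Fin (n + 1), l2 ψ (e i) = l2 Ψ (e i) + l2 Ψ (J i) := by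
    intro i
    obtain ⟨Ce, hCe⟩ := (he i).bounded
    obtain ⟨CJ, hCJ⟩ := (hJphys i).bounded
    have hi1 : Integrable (fun U => Ψ U * e i U) (configMeasure SU2 L) :=
      integrable_of_measurable_abs_le _ (hΨ.measurable.mul (he i).measurable) (C := CΨ * Ce) fun U => by
        rw [abs_mul]; exact mul_le_mul (hCΨ U) (hCe U) (abs_nonneg _) hCΨ0
    have hi2 : Integrable (fun U => Ψ U * J i U) (configMeasure SU2 L) :=
      integrable_of_measurable_abs_le _ (hΨ.measurable.mul (hJphys i).measurable) (C := CΨ * CJ) fun U => by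
        rw [abs_mul]; exact mul_le_mul (hCΨ U) (hCJ U) (abs_nonneg _) hCΨ0
    unfold l2
    rw [← integral_add hi1 hi2]
    refine integral_congr_ae (ae_of_all _ fun U => ?_)
    by_cases hU : U ∈ S
    · simp only [hψdef, hJdef, Set.indicator_of_mem hU, Pi.one_apply]; ring
    · have hΨ0 : Ψ U = 0 := by by_contra h; exact hU (hΨS U h)
      simp only [hψdef, hΨ0]; ring
  set ε : Fin (n + 1) → ℝ := fun i => if (i : ℕ) < n then l2 Ψ (J i) else 0 with hεdef
  have hcε : ∀ i : Fin (n + 1), (if (i : ℕ) < n then l2 ψ (e i) else 0) = a i + ε i := fun i => by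
    by_cases hi : (i : ℕ) < n
    · simp only [hadef, hεdef, hi, if_true, hcoef i]
    · simp only [hadef, hεdef, hi, if_false, add_zero]
  have hε2 : ∑ i, ε i ^ 2 ≤ w ^ 2 * N := by
    have hεi : ∀ i, ε i ^ 2 ≤ l2 (J i) (J i) * N := fun i => by
      by_cases hi : (i : ℕ) < n
      · simp only [hεdef, hi, if_true]
        have := sq_l2_le hΨ (hJphys i)
        rw [hNdef]; linarith
      · simp only [hεdef, hi, if_false]
        rw [zero_pow two_ne_zero]; exact mul_nonneg (l2_self_nonneg_lat _) hN0
    calc ∑ i, ε i ^ 2 ≤ ∑ i, l2 (J i) (J i) * N := Finset.sum_le_sum fun i _ => hεi i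
      _ = (∑ i, l2 (J i) (J i)) * N := by rw [Finset.sum_mul]
      _ ≤ w ^ 2 * N := mul_le_mul_of_nonneg_right hw hN0
  have hc2 : ∑ i : Fin (n + 1), (if (i : ℕ) < n then l2 ψ (e i) else 0) ^ 2 ≤ (Real.sqrt p + w * Real.sqrt N) ^ 2 := by
    have e1 : ∑ i : Fin (n + 1), (if (i : ℕ) < n then l2 ψ (e i) else 0) ^ 2 = ∑ i, (a i + ε i) ^ 2 :=
      Finset.sum_congr rfl fun i _ => by rw [hcε i]
    rw [e1]
    refine (sum_add_sq_le Finset.univ a ε).trans ?_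
    have hsq : Real.sqrt (∑ i, ε i ^ 2) ≤ w * Real.sqrt N := by
      rw [← Real.sqrt_sq hw0, ← Real.sqrt_mul (sq_nonneg w)]
      exact Real.sqrt_le_sqrt hε2
    have h0 : 0 ≤ Real.sqrt p + Real.sqrt (∑ i, ε i ^ 2) := by positivity
    exact pow_le_pow_left₀ h0 (by linarith) 2
  -- endgame: fold the potential into the dressing budget (`κ' = κ + μκ_D/λ_n`, `V' = V + μV_D/λ_n`) when `λ_n > 0`
  have hln : 0 < lam n := levelValue_su2Rep_pos (L := L) hβ n
  have hln0 : 0 ≤ lam n := hln.le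
  have hlkn : lam n ≤ lam k := by
    have hq : qform su2Rep β (e (Fin.last n)) (e (Fin.last n)) = lam n := by
      rw [qform_eigen_right β (heig _), hon]; simp [hlam, Fin.val_last]
    have h1 : l2 (e (Fin.last n)) (e (Fin.last n)) = 1 := by rw [hon]; simp
    have hk' : k < n + 1 := Nat.lt_succ_of_le hkn
    have h := hdom ⟨k, hk'⟩ (e (Fin.last n)) (he _) (fun i' hi' => by
      rw [hon]
      have : Fin.last n ≠ i' := fun h => by
        have h2 : (i' : ℕ) < k := hi'
        rw [← h, Fin.val_last] at h2
        omega
      simp [this])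
    rw [hq, h1, mul_one] at h
    exact h
  set κ' : ℝ := κ + μ * κD / lam n with hκ'def
  set V' : ℝ := V + μ * VD / lam n with hV'def
  set X' : ℝ := X + μ * Y / lam n with hX'def
  have hlnne : lam n ≠ 0 := hln.ne'
  have hV'0 : 0 ≤ V' := by rw [hV'def]; positivity
  have hcancel : ∀ t : ℝ, lam n * (t / lam n) = t := fun t => by rw [← mul_div_assoc, mul_div_cancel_left₀ t hlnne]
  have hX' : X' ≤ 2 * V' * p + 2 * κ' * (N - p) := by
    have h1 : μ / lam n * Y ≤ μ / lam n * (2 * VD * p + 2 * κD * (N - p)) :=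
      mul_le_mul_of_nonneg_left hY (div_nonneg hμ0 hln0)
    have e : 2 * V' * p + 2 * κ' * (N - p) = (2 * V * p + 2 * κ * (N - p)) + μ / lam n * (2 * VD * p + 2 * κD * (N - p)) := by
      rw [hV'def, hκ'def]; ring
    have e2 : X' = X + μ / lam n * Y := by rw [hX'def]; ring
    rw [e2, e]; linarith [hX, h1]
  have hgap' : 2 * κ' * lam n ≤ lam k - lam n := by
    have e : 2 * κ' * lam n = 2 * κ * lam n + 2 * μ * κD := by
      have h := hcancel (μ * κD)
      rw [hκ'def]
      calc 2 * (κ + μ * κD / lam n) * lam n = 2 * κ * lam n + 2 * (lam n * (μ * κD / lam n)) := by ring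
        _ = 2 * κ * lam n + 2 * μ * κD := by rw [h]; ring
    rw [e]; exact hgap
  have hQ : qform su2Rep β ψ ψ + μ * Y ≤ lam n * (N + X') + (lam k - lam n) * ∑ i : Fin (n + 1), (if (i : ℕ) < n then l2 ψ (e i) else 0) ^ 2 := by
    have e : lam n * (N + X') = lam n * (N + X) + μ * Y := by
      have h := hcancel (μ * Y)
      rw [hX'def, mul_add, mul_add, h]; ring
    rw [e, ← hψψ]; linarith [htwo]
  have key := absorb_arith hN0 hp0 hpN hV'0 hw0 hln0 hlkn hgap' hX' hc2 hQ
  have e : (lam k + 2 * lam n * V' + (lam k - lam n) * (2 * w + w ^ 2)) * N =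
      (lam k + 2 * lam n * V + 2 * μ * VD + (lam k - lam n) * (2 * w + w ^ 2)) * N := by
    have h := hcancel (μ * VD)
    have e2 : 2 * lam n * V' = 2 * lam n * V + 2 * (lam n * (μ * VD / lam n)) := by rw [hV'def]; ring
    rw [e2, h]; ring
  rw [e] at key
  exact key

end Summit.QuantumFields.YangMills.Theorems.FemtoTransferGap.RateTube

end
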